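import Literature.NumberTheory.LFunctions.DirichletLOneTail
import Mathlib.NumberTheory.Harmonic.ZetaAsymp
import HarnessLib

/-!
# `L(s, χ)` in the critical strip at Pólya–Vinogradov strength:
# `‖L(σ+it, χ)‖ ≤ e^{3/2} (√q (1 + log q))^{1−σ} (1 + log q) ‖s‖` — the convexity exponent in `q`

Topic `Literature/NumberTheory/LFunctions` (continuing `SiegelAbelSummation.lean`,
`DirichletLOneTail.lean`). Everything in this file is PROVED (theorems only; no definition, no
named fact).

For a primitive Dirichlet character `χ` mod `q ≥ 2` the partial sums `S(N) = ∑_{n ≤ N} χ(n)`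
satisfy `|S(N)| ≤ N` (trivially) and `|S(N)| ≤ B := √q (1 + log q)` (the Pólya–Vinogradov
inequality, the tree's `Literature.NumberTheory.Sieve.LargeSieve.polyaVinogradov` /
`Literature.NumberTheory.LFunctions.DirichletAbel.norm_partialSum_le_polyaVinogradov`, i.e.
Montgomery–Vaughan Theorem 9.18 with the constant `1` of (9.16) for primitive `χ`). Hence
`|S(N)| ≤ min(N, B) ≤ N^{1−δ} B^{δ}` for every `0 ≤ δ ≤ 1`, and Abel summation
`L(s, χ) = ∑_{n ≥ 1} S(n) (n^{−s} − (n+1)^{−s})` (`Re s > 0`, the tree's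
`Literature.NumberTheory.LFunctions.DirichletAbel.LFunction_eq_abelSum`, Montgomery–Vaughan (4.23)
with Theorem 1.3) with `|n^{−s} − (n+1)^{−s}| ≤ ‖s‖ n^{−σ−1}` gives

* `norm_LFunction_le_rpow_polyaVinogradov` — for `0 ≤ δ ≤ 1`, `σ = Re s > 0`, `σ + δ > 1`:
  `‖L(s, χ)‖ ≤ (√q (1 + log q))^{δ} ‖s‖ ∑_{n ≥ 1} n^{−(σ+δ)}`
  (the Pólya–Vinogradov analogue of the tree's trivial-strength
  `Literature.NumberTheory.LFunctions.Siegel.norm_LFunction_le_rpow`, which has `q^{δ}` in place of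
  `(√q (1 + log q))^{δ}`);
* `norm_LFunction_le_polyaVinogradov_convexity` — choosing `δ = 1 − σ + 1/log q`: for `q ≥ 3` and
  `1/log q ≤ σ ≤ 1`,
  `‖L(s, χ)‖ ≤ e^{3/2} (√q (1 + log q))^{1−σ} (1 + log q) ‖s‖`;
* `norm_LFunction_le_polyaVinogradov_of_half_le` — the same for `q ≥ 8`, `½ ≤ σ ≤ 1` (on the
  critical line: `‖L(½+it, χ)‖ ≤ e^{3/2} q^{1/4} (1 + log q)^{3/2} ‖½+it‖`).

In the `q`-aspect this is the CONVEXITY exponent `(1−σ)/2` (up to logarithms): on the line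
`σ = 1 − η` the bound is `≪ q^{η/2+ε} ‖s‖`, versus `q^{η+ε} ‖s‖` from `|S(N)| ≤ min(N, q)` (the
tree's `Literature.NumberTheory.LFunctions.LFDSingle.norm_LFunction_le_left`). The dependence on
`t` is the trivial `‖s‖`; the genuine hybrid convexity bound `L(s, χ) ≪ (q(|t|+2))^{(1−σ)/2+ε}`
(functional equation + Phragmén–Lindelöf, Rademacher 1959) and Burgess's `q^{3/16+ε}` on
`σ = ½` are not proved here. (Use in the tree: this is the size input "convexity in the
`D`-aspect" of the contour shifts in Y. Zhang, arXiv:2211.02515, Lemma 3.1 and in the `ζ⁴L⁴`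
variant of his Lemma 3.2 — `Literature/NumberTheory/LFunctions/Zhang2022/Section3SubconvexInput.lean`,
rows `saves_lemma31_convexity`, `saves_lemma32flat_convexity` — where the `t`-dependence is
absorbed by `Γ(s)`; the printed Lemma 3.2 itself (`ζ⁸L⁸`) needs a subconvex exponent.)

## References

* H. L. Montgomery, R. C. Vaughan, *Multiplicative Number Theory I. Classical Theory*,
  Cambridge Stud. Adv. Math. 97 (2007): §9.4 Theorem 9.18 and (9.16) (Pólya–Vinogradov, constant
  `1` for primitive characters); §4.3 (4.23) with §1.3 Theorem 1.3 (partial summation for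
  `L(s, χ)`); §10.2 Lemma 10.15 (the trivial-strength bound). [cite: MontgomeryVaughan2007,
  Thm 9.18; (4.23); Lemma 10.15]
* The combination "Pólya–Vinogradov + partial summation ⇒ `L(s, χ) ≪ (q^{1/2} log q)^{1−σ} |s| log q`"
  is folklore. [folklore]
-/

noncomputable section

open Complex Filter Topology Finset

namespace Literature.NumberTheory.LFunctions.DirichletAbel

variable {q : ℕ} [NeZero q] (χ : DirichletCharacter ℂ q)

/-! ### Partial sums: `|S(N)| ≤ min(N, √q (1 + log q)) ≤ N^{1−δ} (√q (1 + log q))^{δ}` -/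

omit [NeZero q] in
/-- For `χ` primitive mod `q ≥ 2` and `0 ≤ δ ≤ 1`:
`|S(n+1)| ≤ (n+1)^{1−δ} (√q (1 + log q))^{δ}`, interpolating the trivial bound `|S(n+1)| ≤ n+1`
and the Pólya–Vinogradov bound `|S(n+1)| ≤ √q (1 + log q)`.
[cite: MontgomeryVaughan2007, §9.4 Thm 9.18 and (9.16)] -/
theorem norm_partialSum_succ_le_rpow_polyaVinogradov (hq : 2 ≤ q) (hχ : χ.IsPrimitive) {δ : ℝ}
    (hδ0 : 0 ≤ δ) (hδ1 : δ ≤ 1) (n : ℕ) :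
    ‖partialSum χ (n + 1)‖ ≤
      ((n + 1 : ℕ) : ℝ) ^ (1 - δ) * (Real.sqrt q * (1 + Real.log q)) ^ δ := by
  set B : ℝ := Real.sqrt q * (1 + Real.log q) with hB
  have hq1 : (1 : ℝ) < q := by exact_mod_cast hq
  have hlog : 0 < Real.log q := Real.log_pos hq1
  have hB0 : 0 < B := mul_pos (Real.sqrt_pos.2 (by linarith)) (by linarith)
  have hn : (0 : ℝ) < ((n + 1 : ℕ) : ℝ) := by positivity
  rcases le_or_gt (((n + 1 : ℕ) : ℝ)) B with h | h
  · calc ‖partialSum χ (n + 1)‖ ≤ ((n + 1 : ℕ) : ℝ) := by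
          exact_mod_cast norm_partialSum_le_self χ (n + 1)
      _ = ((n + 1 : ℕ) : ℝ) ^ (1 - δ) * ((n + 1 : ℕ) : ℝ) ^ δ := by
          rw [← Real.rpow_add hn]; simp
      _ ≤ ((n + 1 : ℕ) : ℝ) ^ (1 - δ) * B ^ δ := by
          gcongr
  · calc ‖partialSum χ (n + 1)‖ ≤ B := norm_partialSum_le_polyaVinogradov χ hq hχ (n + 1)
      _ = B ^ (1 - δ) * B ^ δ := by rw [← Real.rpow_add hB0]; simp
      _ ≤ ((n + 1 : ℕ) : ℝ) ^ (1 - δ) * B ^ δ :=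
          mul_le_mul_of_nonneg_right (Real.rpow_le_rpow hB0.le h.le (by linarith))
            (Real.rpow_nonneg hB0.le _)

/-! ### The `δ`-form of the bound for `L(s, χ)` -/

/-- **Pólya–Vinogradov strength partial-summation bound.** For `χ` primitive mod `q ≥ 2`,
`σ = Re s > 0`, `0 ≤ δ ≤ 1` and `σ + δ > 1`:
`‖L(s, χ)‖ ≤ (√q (1 + log q))^{δ} ‖s‖ ∑_{n ≥ 1} n^{−(σ + δ)}`, from
`L(s, χ) = ∑ S(n)(n^{−s} − (n+1)^{−s})`
(`Literature.NumberTheory.LFunctions.DirichletAbel.LFunction_eq_abelSum`) and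
`|S(n)| ≤ min(n, √q (1 + log q)) ≤ n^{1−δ} (√q (1 + log q))^{δ}`.
[cite: MontgomeryVaughan2007, §9.4 Thm 9.18 with §4.3 (4.23) / §10.2 Lemma 10.15] [folklore] -/
theorem norm_LFunction_le_rpow_polyaVinogradov (hq : 2 ≤ q) (hχ : χ.IsPrimitive) {δ : ℝ}
    (hδ0 : 0 ≤ δ) (hδ1 : δ ≤ 1) {s : ℂ} (hs0 : 0 < s.re) (hs : 1 < s.re + δ) :
    ‖χ.LFunction s‖ ≤
      (Real.sqrt q * (1 + Real.log q)) ^ δ * ‖s‖ *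
        ∑' n : ℕ, ((n + 1 : ℕ) : ℝ) ^ (-(s.re + δ)) := by
  set B : ℝ := Real.sqrt q * (1 + Real.log q) with hB
  have hχ1 : χ ≠ 1 := by
    rintro rfl
    rw [DirichletCharacter.isPrimitive_def, DirichletCharacter.conductor_one] at hχ
    omega
  have hsum : Summable fun n : ℕ ↦ ((n + 1 : ℕ) : ℝ) ^ (-(s.re + δ)) := by
    have := summable_rpow_neg (σ := s.re + δ - 1) (by linarith)
    convert this using 2; ring_nf
  rw [LFunction_eq_abelSum χ hχ1 hs0, abelSum, ← tsum_mul_left]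
  refine tsum_of_norm_bounded (hsum.mul_left _).hasSum fun n ↦ ?_
  have hn : (0 : ℝ) < ((n + 1 : ℕ) : ℝ) := by positivity
  calc ‖term χ n s‖
      ≤ ‖partialSum χ (n + 1)‖ * (‖s‖ * ((n + 1 : ℕ) : ℝ) ^ (-s.re - 1)) :=
        norm_term_le' χ n hs0
    _ ≤ (((n + 1 : ℕ) : ℝ) ^ (1 - δ) * B ^ δ) * (‖s‖ * ((n + 1 : ℕ) : ℝ) ^ (-s.re - 1)) := by
        gcongr
        exact norm_partialSum_succ_le_rpow_polyaVinogradov χ hq hχ hδ0 hδ1 n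
    _ = B ^ δ * ‖s‖ * ((n + 1 : ℕ) : ℝ) ^ (-(s.re + δ)) := by
        have : ((n + 1 : ℕ) : ℝ) ^ (1 - δ) * ((n + 1 : ℕ) : ℝ) ^ (-s.re - 1) =
            ((n + 1 : ℕ) : ℝ) ^ (-(s.re + δ)) := by
          rw [← Real.rpow_add hn]; ring_nf
        calc (((n + 1 : ℕ) : ℝ) ^ (1 - δ) * B ^ δ) * (‖s‖ * ((n + 1 : ℕ) : ℝ) ^ (-s.re - 1))
            = B ^ δ * ‖s‖ * (((n + 1 : ℕ) : ℝ) ^ (1 - δ) * ((n + 1 : ℕ) : ℝ) ^ (-s.re - 1)) := by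
              ring
          _ = B ^ δ * ‖s‖ * ((n + 1 : ℕ) : ℝ) ^ (-(s.re + δ)) := by rw [this]

/-! ### Explicit form: the convexity exponent in `q` -/

/-- **`L(s, χ)` at Pólya–Vinogradov strength, explicit form.** For `χ` primitive mod `q ≥ 3` and
`s = σ + it` with `1/log q ≤ σ ≤ 1`:
`‖L(s, χ)‖ ≤ e^{3/2} (√q (1 + log q))^{1−σ} (1 + log q) ‖s‖`
(`norm_LFunction_le_rpow_polyaVinogradov` with `δ = 1 − σ + 1/log q`, where
`∑ n^{−1−1/log q} ≤ 1 + log q` and `(√q (1 + log q))^{1/log q} ≤ e^{3/2}`). In the `q`-aspect the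
exponent `(1 − σ)/2` is the convexity exponent; the `t`-dependence `‖s‖` is the trivial one.
[cite: MontgomeryVaughan2007, §9.4 Thm 9.18 with §4.3 (4.23) / §10.2 Lemma 10.15] [folklore] -/
theorem norm_LFunction_le_polyaVinogradov_convexity (hq : 3 ≤ q) (hχ : χ.IsPrimitive) {s : ℂ}
    (hs0 : 1 / Real.log q ≤ s.re) (hs1 : s.re ≤ 1) :
    ‖χ.LFunction s‖ ≤
      Real.exp (3 / 2) * (Real.sqrt q * (1 + Real.log q)) ^ (1 - s.re) * (1 + Real.log q) *
        ‖s‖ := by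
  set L : ℝ := Real.log q with hL
  set B : ℝ := Real.sqrt q * (1 + L) with hB
  have hq3 : (3 : ℝ) ≤ q := by exact_mod_cast hq
  have hq0 : (0 : ℝ) < q := by linarith
  have hL1 : 1 < L := by
    rw [hL, Real.lt_log_iff_exp_lt hq0]
    have h := Real.exp_one_lt_d9
    norm_num at h
    linarith
  have hL0 : 0 < L := by linarith
  have hsqrt : 0 < Real.sqrt q := Real.sqrt_pos.2 hq0
  have hB0 : 0 < B := mul_pos hsqrt (by linarith)
  -- the choice of `δ`
  set δ : ℝ := 1 - s.re + 1 / L with hδ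
  have hinvL : 0 < 1 / L := one_div_pos.2 hL0
  have hδ0 : 0 ≤ δ := by rw [hδ]; linarith
  have hδ1 : δ ≤ 1 := by rw [hδ]; linarith
  have hs0' : 0 < s.re := lt_of_lt_of_le hinvL hs0
  have hexp : s.re + δ = 1 + 1 / L := by rw [hδ]; ring
  have hsum : 1 < s.re + δ := by rw [hexp]; linarith
  have hmain := norm_LFunction_le_rpow_polyaVinogradov χ (by omega) hχ hδ0 hδ1 hs0' hsum
  -- the zeta tail at `1 + 1/log q`: `∑_{n ≥ 1} n^{−α} ≤ 1 + 1/(α − 1)` (`α > 1`) from Mathlib's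
  -- Euler–Maclaurin identity `ZetaAsymptotics.zeta_limit_aux1` (the general inequality is the
  -- tree's `Literature.Barriers.RiemannHypothesis.tsum_nat_succ_rpow_neg_le`; specialised here to
  -- keep this file's imports inside `NumberTheory/LFunctions` + Mathlib)
  have htsum : ∑' n : ℕ, ((n + 1 : ℕ) : ℝ) ^ (-(s.re + δ)) ≤ 1 + L := by
    rw [hexp]
    have hα : 1 < 1 + 1 / L := by linarith
    have h1 := ZetaAsymptotics.zeta_limit_aux1 hα
    have h2 : 0 ≤ ZetaAsymptotics.termTSum (1 + 1 / L) :=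
      tsum_nonneg fun n ↦ ZetaAsymptotics.term_nonneg (n + 1) _
    have h3 : ∑' n : ℕ, ((n + 1 : ℕ) : ℝ) ^ (-(1 + 1 / L)) =
        ∑' n : ℕ, 1 / (n + 1 : ℝ) ^ (1 + 1 / L) := by
      refine tsum_congr fun n ↦ ?_
      rw [Real.rpow_neg (by positivity)]
      push_cast
      simp only [one_div]
    have h4 : 0 ≤ (1 + 1 / L) * ZetaAsymptotics.termTSum (1 + 1 / L) :=
      mul_nonneg (by linarith) h2
    have h5 : 1 / (1 + 1 / L - 1) = L := by rw [add_sub_cancel_left, one_div_one_div]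
    rw [h3]
    linarith
  -- `B^δ = B^{1-σ} B^{1/L}` and `B^{1/L} ≤ e^{3/2}`
  have hBδ : B ^ δ = B ^ (1 - s.re) * B ^ (1 / L) := by
    rw [hδ, Real.rpow_add hB0]
  have hlogB : Real.log B ≤ 3 / 2 * L := by
    have h1L : Real.log (1 + L) ≤ L := by
      calc Real.log (1 + L) ≤ Real.log (Real.exp L) :=
            Real.log_le_log (by linarith) (by linarith [Real.add_one_le_exp L])
        _ = L := Real.log_exp L
    rw [hB, Real.log_mul hsqrt.ne' (by linarith : (1 + L) ≠ 0), Real.log_sqrt hq0.le, ← hL]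
    linarith
  have hBL : B ^ (1 / L) ≤ Real.exp (3 / 2) := by
    rw [Real.rpow_def_of_pos hB0, Real.exp_le_exp]
    calc Real.log B * (1 / L) = Real.log B / L := by ring
      _ ≤ (3 / 2 * L) / L := by gcongr
      _ = 3 / 2 := by field_simp
  have hnn : 0 ≤ ∑' n : ℕ, ((n + 1 : ℕ) : ℝ) ^ (-(s.re + δ)) :=
    tsum_nonneg fun n ↦ Real.rpow_nonneg (Nat.cast_nonneg _) _
  calc ‖χ.LFunction s‖
      ≤ B ^ δ * ‖s‖ * ∑' n : ℕ, ((n + 1 : ℕ) : ℝ) ^ (-(s.re + δ)) := hmain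
    _ = B ^ (1 - s.re) * B ^ (1 / L) * ‖s‖ * ∑' n : ℕ, ((n + 1 : ℕ) : ℝ) ^ (-(s.re + δ)) := by
        rw [hBδ]
    _ ≤ B ^ (1 - s.re) * Real.exp (3 / 2) * ‖s‖ * (1 + L) := by
        gcongr
    _ = Real.exp (3 / 2) * B ^ (1 - s.re) * (1 + L) * ‖s‖ := by ring

/-- **The case `½ ≤ σ ≤ 1`** (so in particular the critical line). For `χ` primitive mod `q ≥ 8`
(then `log q > 2`, so `1/log q ≤ ½`) and `½ ≤ Re s ≤ 1`:
`‖L(s, χ)‖ ≤ e^{3/2} (√q (1 + log q))^{1−σ} (1 + log q) ‖s‖`; at `σ = ½` this reads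
`‖L(½+it, χ)‖ ≤ e^{3/2} q^{1/4} (1 + log q)^{3/2} ‖½+it‖` — the convexity exponent `¼` in `q`.
[cite: MontgomeryVaughan2007, §9.4 Thm 9.18 with §4.3 (4.23) / §10.2 Lemma 10.15] [folklore] -/
theorem norm_LFunction_le_polyaVinogradov_of_half_le (hq : 8 ≤ q) (hχ : χ.IsPrimitive) {s : ℂ}
    (hs0 : 1 / 2 ≤ s.re) (hs1 : s.re ≤ 1) :
    ‖χ.LFunction s‖ ≤
      Real.exp (3 / 2) * (Real.sqrt q * (1 + Real.log q)) ^ (1 - s.re) * (1 + Real.log q) *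
        ‖s‖ := by
  have hq8 : (8 : ℝ) ≤ q := by exact_mod_cast hq
  have hlog : 2 < Real.log q := by
    rw [Real.lt_log_iff_exp_lt (by linarith)]
    have h1 := Real.exp_one_lt_d9
    have h2 : Real.exp 2 = Real.exp 1 * Real.exp 1 := by rw [← Real.exp_add]; norm_num
    rw [h2]
    norm_num at h1
    nlinarith [Real.exp_pos 1]
  have h : 1 / Real.log q ≤ s.re :=
    (one_div_le_one_div_of_le (by norm_num) hlog.le).trans hs0
  exact norm_LFunction_le_polyaVinogradov_convexity χ (by omega) hχ h hs1

end Literature.NumberTheory.LFunctions.DirichletAbel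

end
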